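import Mathlib
import Summits.ValiantsHypothesis.ValiantsHypothesis.Theses.TwistedDetRank

/-!
# Route TwistedDetRank — support item `DirectSumToTdr` (stmt-ValiantsHypothesis-6288)

Glue: `DirectSumExp` (an exponential lower bound `2^(c·m) ≤ r` for every representation of
`per_3 ⊕ ⋯ ⊕ per_3` (`m` blocks) as a sum of `r` twisted determinants) together with
`TdrBlockMonotone` (block restriction keeps the number of twisted determinants) implies
`TdrPerNotQP` (the twisted-determinantal rank of the permanent is not quasi-polynomially
bounded).  With `n = 3·2^k` and `m = 2^k` blocks a quasi-polynomial bound would give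
`2^(c·2^k) ≤ r ≤ 2^((log₂ n + c')^c') ≤ 2^((k+2+c')^c')`, impossible for large `k`
(a polynomial in `k` is eventually dominated by `c·2^k`).
-/

namespace Summit.ValiantsHypothesis.ValiantsHypothesis.Theorems

open Filter Topology

/-- Analytic core of the glue: for `c > 0` and naturals `d, e` there is `k` with
`(k + d)^e < c · 2^k` (a polynomial in `k` is eventually dominated by `c · 2^k`). -/
theorem directSumToTdr_exists_pow_add_lt (c : ℝ) (hc : 0 < c) (d e : ℕ) :
    ∃ k : ℕ, (((k + d : ℕ) : ℝ)) ^ e < c * (2 : ℝ) ^ k := by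
  have h1 : Tendsto (fun k : ℕ => (((k + d : ℕ) : ℝ)) ^ e / (2 : ℝ) ^ (k + d)) atTop (𝓝 0) :=
    (tendsto_pow_const_div_const_pow_of_one_lt e (one_lt_two : (1 : ℝ) < 2)).comp
      (tendsto_add_atTop_nat d)
  have h2 : ∀ᶠ k : ℕ in atTop, (((k + d : ℕ) : ℝ)) ^ e / (2 : ℝ) ^ (k + d) < c / (2 : ℝ) ^ d :=
    h1.eventually (gt_mem_nhds (by positivity))
  obtain ⟨k, hk⟩ := h2.exists
  refine ⟨k, ?_⟩
  rw [div_lt_div_iff₀ (by positivity) (by positivity), pow_add, ← mul_assoc] at hk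
  exact lt_of_mul_lt_mul_right hk (by positivity)

/-- **Item `stmt-ValiantsHypothesis-6288`** (`DirectSumToTdr`, route TwistedDetRank):
`DirectSumExp → TdrBlockMonotone → TdrPerNotQP`.  Given a quasi-polynomial bound with
constant `c'`, take `n = 3·2^k`, `m = 2^k`: block restriction turns the representation of
`per_n` into one of `per_3^{⊕ m}` with the same number `r ≤ 2^((log₂ n + c')^c')` of twisted
determinants, and `DirectSumExp` forces `2^(c·2^k) ≤ r`; since `log₂ n < k + 2` this gives
`c·2^k ≤ (k + 2 + c')^c'`, contradicting `directSumToTdr_exists_pow_add_lt`. -/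
theorem directSumToTdr_proof :
    Summit.ValiantsHypothesis.ValiantsHypothesis.Theses.TwistedDetRank.DirectSumToTdr := by
  unfold Theses.TwistedDetRank.DirectSumToTdr Theses.TwistedDetRank.DirectSumExp
    Theses.TwistedDetRank.TdrBlockMonotone Theses.TwistedDetRank.TdrPerNotQP
  rintro ⟨c, hc, hDS⟩ hBM ⟨c', h⟩
  obtain ⟨k, hk⟩ := directSumToTdr_exists_pow_add_lt c hc (c' + 2) c'
  obtain ⟨r, hr, E, hE⟩ := h (3 * 2 ^ k)
  obtain ⟨E', hE'⟩ := hBM (3 * 2 ^ k) (2 ^ k) r Nat.one_le_two_pow le_rfl E hE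
  have h2 := hDS (2 ^ k) r E' hE'
  have hlog : Nat.log 2 (3 * 2 ^ k) < k + 2 := by
    rw [Nat.log_lt_iff_lt_pow one_lt_two (by positivity)]
    have := Nat.one_le_two_pow (n := k)
    calc 3 * 2 ^ k < 4 * 2 ^ k := by omega
      _ = 2 ^ (k + 2) := by ring
  have hpow : (Nat.log 2 (3 * 2 ^ k) + c') ^ c' ≤ (k + (c' + 2)) ^ c' :=
    Nat.pow_le_pow_left (by omega) c'
  have hr' : (r : ℝ) ≤ (2 : ℝ) ^ ((k + (c' + 2)) ^ c') :=
    calc (r : ℝ) ≤ (2 : ℝ) ^ ((Nat.log 2 (3 * 2 ^ k) + c') ^ c') := by exact_mod_cast hr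
      _ ≤ (2 : ℝ) ^ ((k + (c' + 2)) ^ c') := pow_le_pow_right₀ one_le_two hpow
  have h3 : c * ((2 ^ k : ℕ) : ℝ) ≤ (((k + (c' + 2)) ^ c' : ℕ) : ℝ) := by
    rw [← Real.rpow_le_rpow_left_iff (one_lt_two : (1 : ℝ) < 2), Real.rpow_natCast]
    exact h2.trans hr'
  push_cast at h3 hk
  linarith [hk, h3]

end Summit.ValiantsHypothesis.ValiantsHypothesis.Theorems
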